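/-
Origin: expansion seat `planner-pub-hodgecm-mc-axioms-1-g14-0`, handover #W55 2026-08-20T15:53:55Z md5 6be23780bc96 (PKG 5494ce1a73cd → 6be23780bc96; 56 l.; MECHANICAL (iib-R) rewrite v3.1 of the PKG file as it stands (8 token edits; rules R1x1+RX[h₂']x3+R3x1+R8x3)) (`HOME/mc/pub-hodgecm-mc-axioms-1-g14/revendor/kit-r55/stage55/HodgeCM/Model/CMInflationPrinted.lean`, md5 6be23780bc96, 56 lines);
landed by the gen-22 packager (p-g22) in gate run 55 REPLACES the earlier landed copy of `HodgeCM/Model/CMInflationPrinted.lean` (seat copy carried the packager Origin header of an earlier run (stripped)).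
-/
/-
Copyright (c) 2026. All rights reserved.
Released under Apache 2.0 license as described in the file LICENSE.
Authors: mc-axioms-1 lineage (gen 3), PerL model-construction cell.
-/
import Summits.HodgeConjecture.HodgeCM.Model.CMInflation
import Literature.AlgebraicGeometry.ComplexMultiplication.ShimuraInflationBettiJunctions

/-!
# G0-(v5) rev 2 — M38 `Fact_cmInflation` on the model universe from the TWO remaining inputs

Carver RULING (I‴) (model1-g4, 2026-08-18T23:26:59Z): the junction hypotheses `hb : isogeny_bettiMap_bijective` and
`hc : product_bettiMap_bijective` of `HodgeCM.Model.fact_cmInflation` are DISCHARGED IN THE KERNEL by the tree leaf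
`Literature/AlgebraicGeometry/ComplexMultiplication/ShimuraInflationBettiJunctions.lean` (mc-period-2-g4; theorems
`isogeny_bettiMap_bijective_holds`, `product_bettiMap_bijective_holds`, `thm3_inflation_of_printed`), so M38 rests on
`hd : Shimura1998_Thm3_isogenousPower` (the one remaining OPEN JUNCTION HYPOTHESIS of G0-d) and
`ha : Shimura1998_Thm2_Cor` (print: Shimura 1998 §6.1 Corollary of Theorem 2 + Remark) only.

This leaf is ADDITIVE over `HodgeCM.Model.CMInflation` (rev 1, four inputs, kept as is) and is installable only together
with the vendored twin of `ShimuraInflationBettiJunctions` and its import cone (V-packet of the period lane / packager).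
0 proof-holes, 0 records, 0 MODEL-N rows.
-/

noncomputable section

namespace HodgeCM

namespace Model

open Literature.AlgebraicGeometry.HodgeTheory Literature.NumberTheory.Automorphic.PicardCM
open Literature.AlgebraicGeometry.ComplexMultiplication

/-- M38 on the generic model universe from `hd`, `ha` alone (`hb`, `hc` := the tree's kernel theorems). -/
theorem universeOf_fact_cmInflation_printed (hHD : exists_isReal_hodgeModel)
    (hI : hodgePQ_independent_of_hodgeModel) (hU : BallQuotientUniformisedDatum) (h₃ : CMAbelianVarietyRealised)
    (hd : Shimura1998_Thm3_isogenousPower) (ha : Shimura1998_Thm2_Cor) :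
    (universeOf hHD hI hU h₃).Fact_cmInflation :=
  universeOf_fact_cmInflation hHD hI hU h₃ hd ha isogeny_bettiMap_bijective_holds product_bettiMap_bijective_holds

/-- **M38 `Fact_cmInflation` on the end-state universe `picardCMUniverse`, two inputs** (node-E binder `h31`, rev 2):
`h31 := HodgeCM.Model.fact_cmInflation_printed hHD hI h₃ h₁ hd ha`. -/
theorem fact_cmInflation_printed (hHD : exists_isReal_hodgeModel) (hI : hodgePQ_independent_of_hodgeModel)
    (h₃ : CMAbelianVarietyRealised) (h₁ : BallQuotientUniformised)
    (hd : Shimura1998_Thm3_isogenousPower) (ha : Shimura1998_Thm2_Cor) :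
    (picardCMUniverse hHD hI h₁ h₃).Fact_cmInflation :=
  fact_cmInflation hHD hI h₃ h₁ hd ha isogeny_bettiMap_bijective_holds product_bettiMap_bijective_holds

end Model

end HodgeCM

end
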